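import Mathlib
import Summits.NavierStokesRegularity.NavierStokesRegularity.Theorems.WakeRatchetTailRatchetRelayFrontUnique
import HarnessLib

/-!
# `WakeRatchet.TailRatchet` (stmt-NavierStokesRegularity-21808): a scalar dyadic front is a fixed point of the
# Picard map — the extended state of a front and the crude size of its bordered right-hand side

Support file for the crux `TailRatchet` (route `WakeRatchet`; MODEL lattice ODEs of Tao 2016 §1.2, §4 —
nothing in this file is a statement about the Navier–Stokes equations, and no item is closed here).

Context (census of stmt-21808, programme R-lac → continuation in `s`; used by `…RelayBranch`):

* `front_state` — a front `(h, δ)` at time ratio `s` (`b = e^{t} + h` solving the scalar front equation on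
  `t < 0`, `h` continuous on `(−∞,0]`, `h(0) = 0`, `|h| ≤ ρe^{t/2}`), extended by `t ↦ h(min(t,0))`, is a
  continuous state on `ℝ` solving the drain-bordered problem with its own forcing `N_s(·, δ)` (a fixed point
  of the Picard map of `…RelayContraction`);
* `bordered_rhs_crude` — in the ball of radius `rc ≤ 1/100` the bordered right-hand side is `≤ 4e^{t/2}`.

HONEST FRAMING: MODEL lattice only; lacunary fronts (LARGE `ε₀`) do NOT refute `TailRatchet` (which needs
`Λ → 1`); the construction item and the crux stay open.
-/

noncomputable section

set_option linter.dupNamespace false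

namespace Summit.NavierStokesRegularity.NavierStokesRegularity.Theorems

namespace WakeRatchetRelayFrontState

open Set Filter Topology MeasureTheory
open WakeRatchetRelayNonlinearMap WakeRatchetRelayFrontUnique

/-! ## A front is a fixed point of the Picard map (extended state) -/

/-- **A front as a Picard state.**  A solution `b = e^{t} + h` of the front equation at `(s, δ)` on `t < 0`
with `h` continuous on `(−∞,0]`, `h(0) = 0`, `|h| ≤ ρe^{t/2}`, extends (by `t ↦ h(min(t,0))`) to a continuous
`g : ℝ → ℝ` agreeing with `h` on `(−∞,0]`, decaying at `−∞`, and solving the drain-bordered problem with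
forcing `N_s(g, δ)` and parameter `δ` on `t < 0`. [folklore] -/
theorem front_state {s δ ρ : ℝ} (hs0 : 0 < s) {h : ℝ → ℝ} (hc : ContinuousOn h (Iic 0)) (h0 : h 0 = 0)
    (hρ : ∀ t : ℝ, t ≤ 0 → |h t| ≤ ρ * Real.exp (t / 2))
    (hf : ∀ t : ℝ, t < 0 → HasDerivAt (fun x => Real.exp x + h x)
        (4 / s ^ 2 * (Real.exp (t / s) + h (t / s)) ^ 2
          - 4 * s * δ * ((Real.exp t + h t) * (Real.exp (s * t) + h (s * t)))) t) :
    ∃ g : ℝ → ℝ, Continuous g ∧ (∀ t : ℝ, t ≤ 0 → g t = h t) ∧ g 0 = 0 ∧ Tendsto g atBot (𝓝 0) ∧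
      (∀ t : ℝ, t ≤ 0 → |g t| ≤ ρ * Real.exp (t / 2)) ∧ (∀ t : ℝ, t ≤ 0 → |g t| ≤ ρ) ∧
      ∀ t : ℝ, t < 0 → HasDerivAt g
        (2 * Real.exp (t / 2) * g (t / 2) +
          (((-(Real.exp t - 4 / s ^ 2 * Real.exp (2 * t / s)) -
              (2 * Real.exp (t / 2) * g (t / 2) - 8 / s ^ 2 * Real.exp (t / s) * g (t / s)) +
              4 / s ^ 2 * g (t / s) ^ 2 -
              δ * (4 * s * ((Real.exp t + g t) * (Real.exp (s * t) + g (s * t))) - 8 * Real.exp (3 * t))))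
            - δ * (8 * Real.exp (3 * t)))) t := by
  set g : ℝ → ℝ := fun t => h (min t 0) with hg
  have hmin : Continuous fun t : ℝ => min t 0 := continuous_id.min continuous_const
  have hgc : Continuous g := hc.comp_continuous hmin fun t => min_le_right t 0
  have heq : ∀ t : ℝ, t ≤ 0 → g t = h t := fun t ht => by simp only [hg, min_eq_left ht]
  have hρ0 : 0 ≤ ρ := by
    have := hρ 0 le_rfl; rw [zero_div, Real.exp_zero, mul_one] at this; exact (abs_nonneg _).trans this
  have hgρ : ∀ t : ℝ, t ≤ 0 → |g t| ≤ ρ * Real.exp (t / 2) := fun t ht => by rw [heq t ht]; exact hρ t ht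
  have hgB : ∀ t : ℝ, t ≤ 0 → |g t| ≤ ρ := fun t ht => (hgρ t ht).trans (by
    have : Real.exp (t / 2) ≤ 1 := Real.exp_le_one_iff.2 (by linarith); nlinarith)
  have hgl : Tendsto g atBot (𝓝 0) := by
    have h0' : Tendsto (fun t : ℝ => ρ * Real.exp (t / 2)) atBot (𝓝 0) := by
      have := (Real.tendsto_exp_atBot.comp (tendsto_id.atBot_div_const (by norm_num : (0:ℝ) < 2))).const_mul ρ
      rwa [mul_zero] at this
    refine squeeze_zero_norm' ?_ h0'
    filter_upwards [eventually_le_atBot (0 : ℝ)] with t ht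
    rw [Real.norm_eq_abs]; exact hgρ t ht
  refine ⟨g, hgc, heq, by rw [heq 0 le_rfl, h0], hgl, hgρ, hgB, fun t ht => ?_⟩
  have hts : t / s ≤ 0 := div_nonpos_of_nonpos_of_nonneg ht.le hs0.le
  have hst : s * t ≤ 0 := mul_nonpos_of_nonneg_of_nonpos hs0.le ht.le
  have h1 : HasDerivAt h (4 / s ^ 2 * (Real.exp (t / s) + h (t / s)) ^ 2
        - 4 * s * δ * ((Real.exp t + h t) * (Real.exp (s * t) + h (s * t))) - Real.exp t) t := by
    have := (hf t ht).sub (Real.hasDerivAt_exp t)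
    refine this.congr_of_eventuallyEq ?_ |>.congr_deriv rfl
    exact Eventually.of_forall fun x => by simp
  have h2 : HasDerivAt g (4 / s ^ 2 * (Real.exp (t / s) + h (t / s)) ^ 2
        - 4 * s * δ * ((Real.exp t + h t) * (Real.exp (s * t) + h (s * t))) - Real.exp t) t := by
    refine h1.congr_of_eventuallyEq ?_
    filter_upwards [Iio_mem_nhds ht] with x hx
    exact heq x (le_of_lt hx)
  refine h2.congr_deriv ?_
  rw [← heq _ hts, ← heq _ ht.le, ← heq _ hst, front_iff_bordered (s := s) (δ := δ) (h := g) t]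

/-! ## Crude size of the bordered right-hand side -/

/-- In the ball of radius `rc ≤ 1/100` the bordered right-hand side is `≤ 4e^{t/2}` (`3/2 ≤ s ≤ 2`, `t < 0`).
[folklore] -/
theorem bordered_rhs_crude {s rc δ : ℝ} (hs3 : 3 / 2 ≤ s) (hs2 : s ≤ 2) (hrc1 : rc ≤ 1 / 100) {g : ℝ → ℝ}
    (hg : ∀ t : ℝ, t ≤ 0 → |g t| ≤ rc * Real.exp (t / 2)) (hδ : |δ| ≤ rc) {t : ℝ} (ht : t < 0) :
    |2 * Real.exp (t / 2) * g (t / 2) +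
      (((-(Real.exp t - 4 / s ^ 2 * Real.exp (2 * t / s)) -
          (2 * Real.exp (t / 2) * g (t / 2) - 8 / s ^ 2 * Real.exp (t / s) * g (t / s)) +
          4 / s ^ 2 * g (t / s) ^ 2 -
          δ * (4 * s * ((Real.exp t + g t) * (Real.exp (s * t) + g (s * t))) - 8 * Real.exp (3 * t))))
        - δ * (8 * Real.exp (3 * t)))| ≤ 4 * Real.exp (t / 2) := by
  have hrc0 : 0 ≤ rc := (abs_nonneg _).trans hδ
  rw [← front_iff_bordered (s := s) (δ := δ) (h := g) t]
  refine (front_rhs_crude hs3 hs2 hg hδ ht).trans (mul_le_mul_of_nonneg_right ?_ (Real.exp_pos _).le)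
  have h1 : (1 + rc) ^ 2 ≤ 10201 / 10000 := by nlinarith only [hrc0, hrc1]
  have h2 : rc * (1 + rc) ^ 2 ≤ 1 / 100 * (10201 / 10000) :=
    mul_le_mul hrc1 h1 (by positivity) (by norm_num)
  nlinarith only [h1, h2]

end WakeRatchetRelayFrontState

end Summit.NavierStokesRegularity.NavierStokesRegularity.Theorems

end
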